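/-
Origin: expansion seat `planner-pub-hodgecm-toy-g5-0`, handover #2 2026-08-18T14:13:07Z (md5 f4cbc2e0) (`HOME/pub-hodgecm-toy-g5/lean/ToyG5/HodgeRiemannKernel3.lean`, md5 f4cbc2e0, 224 lines);
landed by the gen-8 packager in gate run 31 as `HodgeCM/Model/ToyG2/HodgeRiemannKernel3.lean` (verbatim).
-/
/-
Copyright (c) 2026. All rights reserved.
Released under Apache 2.0 license as described in the file LICENSE.
-/
import Mathlib
import Summits.HodgeConjecture.HodgeCM.Model.ToyG2.ThetaGram_4
import Summits.HodgeConjecture.HodgeCM.Model.ToyG2.SplitAllGood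
import Summits.HodgeConjecture.HodgeCM.Proofs.RealisationConstruction
import Summits.HodgeConjecture.HodgeCM.Automorphic.ThetaFacts

/-!
# HodgeCM.Model.ToyG2.HodgeRiemannKernel3 — the Gram map of the realisation of record has a kernel on `F²H²`

pub-hodgecm cell, seat `planner-pub-hodgecm-toy-g5-0` (EXPANSION part (e), CONSISTENCY WITNESS, generation 5),
2026-08-18.  Intended tree location `HodgeCM/Model/ToyG2/HodgeRiemannKernel3.lean`; companion of
`HodgeCM.Model.ToyG2.HodgeRiemann3` (`¬ (toyUniverse₃ d t).Fact_hodgeRiemann20` for all `d t` from CROSS-BLOCK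
classes).

Here the failure of the Hodge–Riemann `(2,0)` relation (`Universe.Fact_hodgeRiemann20`) is located INSIDE ONE BLOCK
of the period leaf, for the parameters `1 ≤ d`, `t² = 16` of the theta realisation of record
(`ThetaModel3.thetaRealisation₃`, whose Gram map at every level is `ThetaGram.Λ ι₁ d t hd ht` with
`inner_Λ`-constant `¼`).  For ANY CM field `L`, embedding `ι₁`, hermitian space `V`, level `Γ` and block `q`, with
`θ = ι₁` (transported) and the single eigenvectors `Eᵢ = E_{q,i,θ}` (pv03-g5 `ThetaUiso.eCls`):

* `hr3_trC_sub_smul` — generic expansion (any Universe) of `tr_ℂ(η ∪ η̄)` for `η = a ∪ b − κ • c ∪ e`, `κ ∈ ℝ`, into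
  four values of the quadrilinear period `period4`;
* `hr3_period4_eq_inner` — the Gram identity `ThetaGram.inner_Λ₃` read as
  `period(ω₀, ω₁, ω₂, ω₃) = 4 ⟪Λ(ω₂, ω₃), Λ(ω₀, ω₁)⟫`;
* `hr3_eta` — the class `η_q := E₀ ∪ E₁ − κ • E₂ ∪ E₃ ∈ H²(P_Γ, ℂ)`, `κ = β₀(θ)/α₀(θ) ∈ ℝ` the kernel-relation
  constant of toy-g2's singular `2 × 2` block (`BlockData.g_sec_zero_eq_smul`);
* `hr3_eta_mem_F2`, `hr3_eta_ne_zero` — `η_q` is a nonzero `(2,0)`-class (coordinate functionals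
  `ThetaUiso.coordAt` and the determinant pairing `exteriorPower.pairingDual`);
* `hr3_trC_eta` — `tr_ℂ(η_q ∪ η̄_q) = 4 ‖Λ(E₀,E₁) − κ Λ(E₂,E₃)‖² = 0` by the KERNEL RELATION
  `Λ(E₀, E₁) = κ • Λ(E₂, E₃)` (`ThetaGram.Λ_theta01_eq_smul`, the very input of `gen12`/`real34`/`lineField` in
  `thetaRealisation₃`);
* `hr3_kernelBlock` — packaged: every block of every period surface carries such a class; hence
  `not_toyUniverse₃_hodgeRiemann20_of_block` (HR20 fails as soon as one period leaf has a block — it always does,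
  `PeriodLeaf.qAt`).

Diagnosis (for the successor, `HOME/pub-hodgecm-toy-g5/TOY-G5.md`): in `toyUniverse₃` one has `H² = ⋀² H¹` on the
period surfaces, so `E₀ ∪ E₁` and `E₂ ∪ E₃` stay independent in cohomology while the realisation identifies their
Gram vectors; a universe witnessing `Fact_hodgeRiemann20 ∧ T.Inputs` must divide `⋀² H¹(P)` by the radical of the
form `(η, η') ↦ tr(η ∪ η̄')` on `F²` (as the cohomology of a genuine Picard surface does: `h^{2,0}(S_Γ) < C(h^{1,0}, 2)`
in general), i.e. the model's `H²(pms)` cannot be the full exterior square.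

Everything is kernel-proved from the tree (pv03-g5 `ThetaUiso`/`ThetaPeriod`/`ThetaGram`, toy-g3 `SplitAllGood`,
`Proofs.RealisationConstruction`); nothing cited, nothing posited, no unfinished proofs.
-/

open scoped TensorProduct InnerProductSpace
open HodgeCM.Toy HodgeCM.Toy.CMPresentation exteriorPower NumberField.ComplexEmbedding
open Literature.AlgebraicGeometry.Motives
open Literature.AlgebraicGeometry.Motives.HodgeStructure (conj conj_smul)

namespace HodgeCM.ToyG2

open ThetaUiso

noncomputable section

section KernelBlock

variable (d t : ℚ) {L : CMField} (ι₁ : L →+* ℂ) {V : HermSpace3 L ι₁} (Γ : Level V)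
  (hd : (1 : ℚ) ≤ d) (ht : t ^ 2 = 16) (q : Fin (nQ L ι₁))

/-- the transported embedding `θ = ι₁ ∘ eK⁻¹` is holomorphic for every slot of every block (as in `HodgeRiemann3`) -/
theorem hr3k_embOf_hol (i : Fin 4) : (embOf L ι₁).comp (eK L : L →+* FK L) ∈ (ΘOf L ι₁ q i).1 := by
  rw [embOf_comp]
  exact mem_ΘOf L ι₁ q i

/-- the single eigenvector `E_{q,i,θ}` is a `(1,0)`-class of the period surface -/
theorem hr3k_eCls_mem_H10 (i : Fin 4) :
    eCls ι₁ d t q i (embOf L ι₁) ∈ (toyUniverse₃ d t).H10 ((toyUniverse₃ d t).pms L ι₁ V Γ) :=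
  eCls_mem_H10₃ d t ι₁ Γ q i (hr3k_embOf_hol ι₁ q i)

/-- **generic expansion** (any Universe): for degree-one classes `a b c e` and a real scalar `κ`,
`tr_ℂ((a∪b − κ c∪e) ∪ conj(a∪b − κ c∪e)) = P(a,b,a,b) − κ P(a,b,c,e) − κ P(c,e,a,b) + κ² P(c,e,c,e)`, `P = period4`
(`conj (x ∪ y) = x̄ ∪ ȳ`, bilinearity of `∪`, linearity of `tr`). -/
theorem hr3_trC_sub_smul (U : Universe) (X : U.Var) (a b c e : U.CohC X 1) (κ : ℝ) :
    U.trC X 4 (U.cup2C X 2 (U.cup2C X 1 a b - (κ : ℂ) • U.cup2C X 1 c e)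
        (conj (U.cup2C X 1 a b - (κ : ℂ) • U.cup2C X 1 c e)))
      = U.period4 X a b a b - κ * U.period4 X a b c e - κ * U.period4 X c e a b
          + κ * κ * U.period4 X c e c e := by
  -- `conj (x ∪ y) = x̄ ∪ ȳ`, read in `H²` (the degree `1 + 1` of `cup2C` is the degree `2` of `period4`)
  have hc : ∀ x y : U.CohC X 1, (conj (U.cup2C X 1 x y) : U.CohC X 2) = U.cup2C X 1 (conj x) (conj y) :=
    fun x y => Universe.conj_cup2C X 1 x y
  simp only [map_sub, conj_smul, Complex.conj_ofReal, hc, map_smul, LinearMap.sub_apply, LinearMap.smul_apply,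
    Universe.period4, Universe.quadC, smul_eq_mul]
  ring

/-- **the Gram identity of the realisation of record**, solved for the period:
`period4(ω₀, ω₁, ω₂, ω₃) = 4 ⟪Λ(ω₂, ω₃), Λ(ω₀, ω₁)⟫` for `(1,0)`-classes -/
theorem hr3_period4_eq_inner (a b c e : (toyUniverse₃ d t).CohC ((toyUniverse₃ d t).pms L ι₁ V Γ) 1)
    (ha : a ∈ (toyUniverse₃ d t).H10 ((toyUniverse₃ d t).pms L ι₁ V Γ))
    (hb : b ∈ (toyUniverse₃ d t).H10 ((toyUniverse₃ d t).pms L ι₁ V Γ))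
    (hc : c ∈ (toyUniverse₃ d t).H10 ((toyUniverse₃ d t).pms L ι₁ V Γ))
    (he : e ∈ (toyUniverse₃ d t).H10 ((toyUniverse₃ d t).pms L ι₁ V Γ)) :
    (toyUniverse₃ d t).period4 ((toyUniverse₃ d t).pms L ι₁ V Γ) a b c e
      = 4 * ⟪Λ ι₁ d t hd ht c e, Λ ι₁ d t hd ht a b⟫_ℂ := by
  have hω : ∀ i, (![a, b, c, e] : Fin 4 → _) i ∈ (toyUniverse₃ d t).H10 ((toyUniverse₃ d t).pms L ι₁ V Γ) := by
    intro i
    fin_cases i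
    · exact ha
    · exact hb
    · exact hc
    · exact he
  have h : ⟪Λ ι₁ d t hd ht c e, Λ ι₁ d t hd ht a b⟫_ℂ
      = (1 / 4 : ℂ) * (toyUniverse₃ d t).period4 ((toyUniverse₃ d t).pms L ι₁ V Γ) a b c e := by
    have h' := inner_Λ₃ d t ι₁ Γ hd ht ![a, b, c, e] hω
    rw [Universe.period_eq_period4] at h'
    exact h'
  rw [h]
  ring

open scoped Classical in
/-- the kernel-relation constant `κ = β₀(θ)/α₀(θ)` of block `q` at `θ = ι₁` (a REAL number) -/
def hr3_κ : ℝ :=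
  (ThetaUiso.blockData ι₁ d t hd ht q).β 0 (embOf L ι₁) / (ThetaUiso.blockData ι₁ d t hd ht q).α 0 (embOf L ι₁)

/-- **the class `η_q := E_{q,0,θ} ∪ E_{q,1,θ} − κ • E_{q,2,θ} ∪ E_{q,3,θ} ∈ H²(P_Γ, ℂ)`** -/
def hr3_eta : (toyUniverse₃ d t).CohC ((toyUniverse₃ d t).pms L ι₁ V Γ) (1 + 1) :=
  (toyUniverse₃ d t).cup2C ((toyUniverse₃ d t).pms L ι₁ V Γ) 1
      (eCls ι₁ d t q 0 (embOf L ι₁)) (eCls ι₁ d t q 1 (embOf L ι₁))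
    - ((hr3_κ d t ι₁ hd ht q : ℝ) : ℂ) •
      (toyUniverse₃ d t).cup2C ((toyUniverse₃ d t).pms L ι₁ V Γ) 1
        (eCls ι₁ d t q 2 (embOf L ι₁)) (eCls ι₁ d t q 3 (embOf L ι₁))

/-- `η_q ∈ F²H²(P_Γ)` (cup products of `(1,0)`-classes, `cup2C_mem_F2`) -/
theorem hr3_eta_mem_F2 :
    hr3_eta d t ι₁ Γ hd ht q ∈ ((toyUniverse₃ d t).hodge ((toyUniverse₃ d t).pms L ι₁ V Γ) 2).F 2 := by
  unfold hr3_eta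
  exact Submodule.sub_mem _
    (Universe.cup2C_mem_F2 (toyUniverse₃_modelAxioms_all d t) _ (hr3k_eCls_mem_H10 d t ι₁ Γ q 0)
      (hr3k_eCls_mem_H10 d t ι₁ Γ q 1))
    (Submodule.smul_mem _ _ (Universe.cup2C_mem_F2 (toyUniverse₃_modelAxioms_all d t) _
      (hr3k_eCls_mem_H10 d t ι₁ Γ q 2) (hr3k_eCls_mem_H10 d t ι₁ Γ q 3)))

/-- the coordinate functionals of block `q` at `θ` see the four eigenvectors `E_{q,i,θ}` diagonally -/
theorem hr3_coordAt_eVec (i i' : Fin 4) :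
    coordAt ι₁ d t q i' (embOf L ι₁) (eVec ι₁ d t q i (embOf L ι₁)) = if i = i' then 1 else 0 := by
  split_ifs with h
  · subst h
    exact coordAt_eVec_self ι₁ d t q i (embOf L ι₁)
  · exact coordAt_eVec_of_ne ι₁ d t (Or.inr (Or.inl h))

/-- the determinant functional `ψ = ε_{q,0,θ} ∧ ε_{q,1,θ}` on `⋀²_ℂ H¹`, pulled back along `Θ₂`, evaluated on
`E_{q,a,θ} ∪ E_{q,b,θ}`: the `2 × 2` minor of the coordinates -/
theorem hr3_psi_cup (a b : Fin 4) :
    pairingDual ℂ (PO ι₁ d t).LC 2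
        (ιMulti ℂ 2 ![coordAt ι₁ d t q 0 (embOf L ι₁), coordAt ι₁ d t q 1 (embOf L ι₁)])
        ((PO ι₁ d t).Θ 2 (LinearMap.BilinMap.baseChange ℂ (wedge ℚ (PO ι₁ d t).L 1 1)
          (eCls ι₁ d t q a (embOf L ι₁)) (eCls ι₁ d t q b (embOf L ι₁))))
      = (if a = 0 then 1 else 0) * (if b = 1 then 1 else 0)
        - (if a = 1 then 1 else 0) * (if b = 0 then 1 else 0) := by
  rw [eCls_eq_form1, eCls_eq_form1, theta_pair, pairingDual_ιMulti_ιMulti, Matrix.det_fin_two]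
  simp only [Matrix.of_apply, Matrix.cons_val_zero, Matrix.cons_val_one, hr3_coordAt_eVec]

/-- **`η_q ≠ 0`**: the functional `ψ ∘ Θ₂` takes the value `1` on it -/
theorem hr3_eta_ne_zero : hr3_eta d t ι₁ Γ hd ht q ≠ 0 := by
  intro h0
  have h0' : LinearMap.BilinMap.baseChange ℂ (wedge ℚ (PO ι₁ d t).L 1 1)
        (eCls ι₁ d t q 0 (embOf L ι₁)) (eCls ι₁ d t q 1 (embOf L ι₁))
      - ((hr3_κ d t ι₁ hd ht q : ℝ) : ℂ) • LinearMap.BilinMap.baseChange ℂ (wedge ℚ (PO ι₁ d t).L 1 1)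
        (eCls ι₁ d t q 2 (embOf L ι₁)) (eCls ι₁ d t q 3 (embOf L ι₁)) = 0 := h0
  have key := congrArg (fun x => pairingDual ℂ (PO ι₁ d t).LC 2
      (ιMulti ℂ 2 ![coordAt ι₁ d t q 0 (embOf L ι₁), coordAt ι₁ d t q 1 (embOf L ι₁)])
      ((PO ι₁ d t).Θ 2 x)) h0'
  simp only [map_sub, map_smul, map_zero, hr3_psi_cup] at key
  simp at key

/-- **`tr_ℂ(η_q ∪ η̄_q) = 0`**: by the Gram identity and the KERNEL RELATION `Λ(E₀,E₁) = κ • Λ(E₂,E₃)` of the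
realisation of record, `tr_ℂ(η_q ∪ η̄_q) = 4 ‖Λ(E₀,E₁) − κ Λ(E₂,E₃)‖² = 0`. -/
theorem hr3_trC_eta :
    (toyUniverse₃ d t).trC ((toyUniverse₃ d t).pms L ι₁ V Γ) 4
        ((toyUniverse₃ d t).cup2C ((toyUniverse₃ d t).pms L ι₁ V Γ) 2
          (hr3_eta d t ι₁ Γ hd ht q) (conj (hr3_eta d t ι₁ Γ hd ht q))) = 0 := by
  have hH := hr3k_eCls_mem_H10 d t ι₁ Γ q
  unfold hr3_eta
  rw [hr3_trC_sub_smul]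
  rw [hr3_period4_eq_inner d t ι₁ Γ hd ht _ _ _ _ (hH 0) (hH 1) (hH 0) (hH 1),
    hr3_period4_eq_inner d t ι₁ Γ hd ht _ _ _ _ (hH 0) (hH 1) (hH 2) (hH 3),
    hr3_period4_eq_inner d t ι₁ Γ hd ht _ _ _ _ (hH 2) (hH 3) (hH 0) (hH 1),
    hr3_period4_eq_inner d t ι₁ Γ hd ht _ _ _ _ (hH 2) (hH 3) (hH 2) (hH 3)]
  have hθ := hr3k_embOf_hol ι₁ q
  -- the kernel relation of the realisation of record, `Λ(E₀, E₁) = Λ(E₂, κ • E₃)` (`= κ • Λ(E₂, E₃)`, written through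
  -- the linearity of `Λ` so that the scalar action is the module one)
  have hAB : Λ ι₁ d t hd ht (eCls ι₁ d t q 0 (embOf L ι₁)) (eCls ι₁ d t q 1 (embOf L ι₁))
      = Λ ι₁ d t hd ht (eCls ι₁ d t q 2 (embOf L ι₁))
          (((hr3_κ d t ι₁ hd ht q : ℝ) : ℂ) • eCls ι₁ d t q 3 (embOf L ι₁)) := by
    rw [LinearMap.map_smul]
    exact Λ_theta01_eq_smul ι₁ d t q hd ht (hθ 0) (hθ 1) (hθ 2) (hθ 3)
  rw [hAB, LinearMap.map_smul]
  -- `4‖κB‖² − κ·4⟪B, κB⟫ − κ·4⟪κB, B⟫ + κ²·4‖B‖² = 0` (`κ` real), with `B = Λ(E₂, E₃)` abstracted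
  generalize Λ ι₁ d t hd ht (eCls ι₁ d t q 2 (embOf L ι₁)) (eCls ι₁ d t q 3 (embOf L ι₁)) = B
  generalize hr3_κ d t ι₁ hd ht q = k
  rw [inner_smul_left, inner_smul_left, inner_smul_right, Complex.conj_ofReal]
  ring

include hd ht q in
/-- **THE KERNEL BLOCK.**  Every block `q` of every period surface of `toyUniverse₃ d t` (`1 ≤ d`, `t² = 16`)
carries a nonzero `(2,0)`-class `η_q` with `tr_ℂ(η_q ∪ η̄_q) = 0`, built from the realisation of record's own
theta vectors. -/
theorem hr3_kernelBlock :
    ∃ η : (toyUniverse₃ d t).CohC ((toyUniverse₃ d t).pms L ι₁ V Γ) 2,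
      η ∈ ((toyUniverse₃ d t).hodge ((toyUniverse₃ d t).pms L ι₁ V Γ) 2).F 2 ∧ η ≠ 0 ∧
      (toyUniverse₃ d t).trC ((toyUniverse₃ d t).pms L ι₁ V Γ) 4
        ((toyUniverse₃ d t).cup2C ((toyUniverse₃ d t).pms L ι₁ V Γ) 2 η (conj η)) = 0 :=
  ⟨hr3_eta d t ι₁ Γ hd ht q, hr3_eta_mem_F2 d t ι₁ Γ hd ht q, hr3_eta_ne_zero d t ι₁ Γ hd ht q,
    hr3_trC_eta d t ι₁ Γ hd ht q⟩

end KernelBlock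

/-- **HR20 fails at every period surface with a hermitian space**, for the parameters of the realisation of record
— independently of cross-block classes (one block suffices: `PeriodLeaf.qAt`). -/
theorem not_toyUniverse₃_hodgeRiemann20_of_block (d t : ℚ) (hd : (1 : ℚ) ≤ d) (ht : t ^ 2 = 16)
    {L : CMField} (ι₁ : L →+* ℂ) (V : HermSpace3 L ι₁) : ¬ (toyUniverse₃ d t).Fact_hodgeRiemann20 := by
  intro hHR
  obtain ⟨Γ⟩ := Level.nonempty V
  obtain ⟨η, hF2, hne, h0⟩ := hr3_kernelBlock d t ι₁ Γ hd ht (eQ L ι₁ (qAt L ι₁))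
  exact hHR _ ((toyUniverse₃_modelAxioms_all d t).pms_dim L ι₁ V Γ) η hF2 hne h0

end

end HodgeCM.ToyG2
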